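import Literature.NumberTheory.Sieve.HeathBrownMorozClassFLASide
import HarnessLib

/-!
# The Fundamental-Lemma comparison for a residue class, with explicit constants (HBM Lemma 3.1, II)

Pure-proof file in the residue-class ("coset") port of D. R. Heath-Brown, *Primes represented by
`x³ + 2y³`*, Acta Math. 186 (2001), §6 (proof of Lemma 3.5), to the class `x ≡ a, y ≡ b (mod d)`
of Heath-Brown–Moroz, Proc. LMS 88 (2004), Lemma 3.1: the class analogue of
`sum_abs_Tpiece_sub_le_explicit` (`HeathBrownCubicFLAssembly`).  With `ω = w(d)/d²`
(`classWeight d / d²`) and the comparison constant `κ_f = classKappa = ω·κ` of [HBM, (3.1)]: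
`∑_{n<N} |T^(n)(𝒜_f) − κ_f T^(n)(ℬ)| ≤ C_𝒜 X_{𝒜_f}V_{𝒜_f}e^{-s}e^{W₁} + [class level sum]
   + ω·κQ_ℬe^{W₁} + ω·η²X²e^{W₁}{C₇V/log z + σ₀C₉V/log z + σ₀V(W₁X^{-τ} + 12(z/2)^{-1/3} + …)}`
for `z = X^τ > d`: the class main term is `X_{𝒜_f}V_{𝒜_f}Σ₀ = ω·X_𝒜V_𝒜Σ₀`
(`classSizeA_mul_classProd`), so `M_{𝒜_f}(n) − κ_f M_ℬ(n) = ω(M_𝒜(n) − κM_ℬ(n))` and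
Heath-Brown's main-term comparison (`mainTerms_eq`, (6.7), (6.9), the chain sums) applies verbatim
with the factor `ω`; the `𝒜`-side is `abs_TpieceClassA_sub_le` + `sum_remaindersClassA_le`, the
`ℬ`-side is `abs_TpieceB_sub_le` unchanged.
What remains for HBM Lemma 3.1 (= the class Lemma 3.5, hypothesis `h35` of
`Summit…heathBrownMorozUniform_of_classLemmas`) is the choice of parameters exactly as in
`lemma_3_5_bound_of_params` / `HeathBrown2001_lemma_3_5_of`, with `class_level` as the level input
and `X₀ ≥ d`-dependent thresholds.
[cite: HeathBrownMoroz2004, Lemma 3.1 and (3.1)] [cite: HeathBrownActa2001, §6 pp. 35–39]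
Search: `lean search 'sum_abs_Tpiece_sub_le_explicit'` — the `d = 1` version only.
-/

noncomputable section

open NumberField Finset Filter

open scoped Topology

namespace Literature.NumberTheory.Sieve.CubicSieve

open LFunctions.CubeRootTwoField CubicPrimes

set_option maxHeartbeats 800000 in
open scoped Classical in
/-- **The class comparison of HBM Lemma 3.1 with all constants explicit** (class analogue of
`sum_abs_Tpiece_sub_le_explicit`). For `X ≥ 1`, `0 ≤ η ≤ 1`, `z = X^τ ≥ 16`, `z > d`, `z` in the
range of (6.7) and (6.9), `z ≤ D`, `DX^{1+τ} ≤ X^{3/2}`, with `ω = w(d)/d²`: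
`∑_{n<N} |T^(n)(𝒜_f) − classKappa·T^(n)(ℬ)| ≤ C_𝒜X_{𝒜_f}V_{𝒜_f}e^{-s}e^{W₁} + [class level sum]
  + ω(κQ_ℬe^{W₁}) + ω(η²X²e^{W₁}{…})`. [cite: HeathBrownMoroz2004, Lemma 3.1]
[cite: HeathBrownActa2001, §6 pp. 35–39] -/
theorem class_sum_abs_Tpiece_sub_le_explicit {σ₀ : ℝ} (hσ₀ : 0 < σ₀)
    {C_A : ℝ} (hFLA : FLBound dimConst C_A) (hCA : 0 ≤ C_A)
    {K₀ C_FL C_W C_B : ℝ} (hFLB : FLBound K₀ C_FL) (hCFL : 0 ≤ C_FL)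
    (hK : HasSieveDimension normDensity 3 K₀)
    (hW : WindowBound C_W) (hCW : 0 ≤ C_W) (hB : CountBBound C_B) (hCB : 0 ≤ C_B)
    {C₇ z₇ : ℝ} (h7 : ∀ z : ℝ, z₇ ≤ z →
      |6 / Real.pi ^ 2 * prodA z - σ₀ * mertensProd z| ≤ C₇ * mertensProd z / Real.log z)
    {C₉ z₉ : ℝ} (h9 : ∀ z : ℝ, z₉ ≤ z →
      |gamma₀ * prodB z - mertensProd z| ≤ C₉ * mertensProd z / Real.log z)
    {d : ℕ} (hd : 0 < d) (a b : ℕ)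
    {X η τ D : ℝ} (hX : 1 ≤ X) (hη0 : 0 ≤ η) (hη1 : η ≤ 1) (hz16 : 16 ≤ X ^ τ) (hz7 : z₇ ≤ X ^ τ)
    (hz9 : z₉ ≤ X ^ τ) (hdz : (d : ℝ) < X ^ τ) (hzD : X ^ τ ≤ D)
    (hD : D * X ^ (1 + τ) ≤ X ^ (3 / 2 : ℝ)) (N : ℕ) :
    ∑ n ∈ range N, |(Tpiece (classPairs X η d a b) pairIdeal X τ n : ℝ) -
        classKappa σ₀ X η d * Tpiece (normWindow X η) (fun J => J) X τ n| ≤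
      C_A * classSizeA X η d * (prodA (X ^ τ) * ∏ p ∈ d.primeFactors, (1 - densA p)⁻¹) *
          Real.exp (-(Real.log D / Real.log (X ^ τ))) * Real.exp (smallPrimesWeight X τ) +
        ∑ R ∈ (idealsLE ⌊X ^ (3 / 2 : ℝ)⌋₊).filter (fun R => Squarefree (Ideal.absNorm R)),
          |(classCountA X η d a b R : ℝ) -
            (if Nat.Coprime d (Ideal.absNorm R) then
              classSizeA X η d * rho₂ R / Ideal.absNorm R else 0)| +
        classWeight d / (d : ℝ) ^ 2 *
          (kappa σ₀ X η * (errB C_FL C_W C_B X η τ D * Real.exp (smallPrimesWeight X τ))) +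
        classWeight d / (d : ℝ) ^ 2 * (η ^ 2 * X ^ 2 * Real.exp (smallPrimesWeight X τ) *
          (C₇ * mertensProd (X ^ τ) / Real.log (X ^ τ) +
            σ₀ * (C₉ * mertensProd (X ^ τ) / Real.log (X ^ τ)) +
            σ₀ * mertensProd (X ^ τ) *
              (smallPrimesWeight X τ * (X ^ τ)⁻¹ + 12 / (X ^ τ / 2) ^ (1 / 3 : ℝ) +
                54 / (X ^ τ / 2)))) := by
  set z := X ^ τ with hz
  set W := smallPrimesWeight X τ with hWdef
  set V := mertensProd z with hV
  set κ := kappa σ₀ X η with hκ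
  set ω := classWeight d / (d : ℝ) ^ 2 with hω
  set PA := prodA z with hPA
  set PB := prodB z with hPB
  set Vf := prodA z * ∏ p ∈ d.primeFactors, (1 - densA p)⁻¹ with hVf
  set Sf := classSizeA X η d with hSf
  set E := Real.exp (-(Real.log D / Real.log z)) with hE
  have hX0 : 0 < X := by linarith
  have hκ0 : 0 ≤ κ := by rw [hκ, kappa]; positivity
  have hω0 : 0 ≤ ω := by
    rw [hω]; exact div_nonneg (classWeight_pos d).le (by positivity)
  have hκf : classKappa σ₀ X η d = ω * κ := classKappa_def σ₀ X η d
  obtain ⟨hV0, hV1⟩ := mertensProd_pos_le z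
  obtain ⟨hPA0, hPA1⟩ := prodA_pos_le z
  have hsA := sizeA_nonneg X η
  have hE0 : 0 ≤ E := (Real.exp_pos _).le
  -- the class main term is `ω` times Heath-Brown's
  have hωeq : Sf * Vf = ω * (sizeA X η * PA) := by
    rw [hSf, hVf, hω, hPA, ← classProd_eq hd hdz, classSizeA_mul_classProd hd hdz]
  -- per-`n` decomposition
  set TA : ℕ → ℝ := fun n => (Tpiece (classPairs X η d a b) pairIdeal X τ n : ℝ) with hTA
  set TB : ℕ → ℝ := fun n => (Tpiece (normWindow X η) (fun J => J) X τ n : ℝ) with hTB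
  set S₀ := chainSumA X τ with hS₀
  set S₁ := chainSumB X τ with hS₁
  set remA : ℕ → ℝ := fun n => ∑ t ∈ ratChains X τ n,
    ∑ e ∈ (primesProdBelow z).divisors.filter (fun e : ℕ => (e : ℝ) ≤ D),
      |(classSeqA X η d a b (∏ p ∈ t, p)).remainder e (topA X η)| with hremA
  have hA : ∀ n, |TA n - Sf * Vf * S₀ n| ≤ C_A * Sf * Vf * E * S₀ n + remA n := fun n =>
    abs_TpieceClassA_sub_le hFLA hd a b hX0.le (by linarith) hdz hzD n
  have hBn : ∀ n, |TB n - 3 * gamma₀ * η * X ^ 3 * PB * S₁ n| ≤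
      errB C_FL C_W C_B X η τ D * S₁ n := fun n =>
    abs_TpieceB_sub_le hFLB hK hW hCW hB hX hη0 hη1 (by linarith) hzD n
  have hM : ∀ n, |sizeA X η * PA * S₀ n - κ * (3 * gamma₀ * η * X ^ 3 * PB * S₁ n)| ≤
      η ^ 2 * X ^ 2 * (C₇ * V / Real.log z * S₀ n + σ₀ * (C₉ * V / Real.log z) * S₁ n +
        σ₀ * V * |S₀ n - S₁ n|) := by
    intro n
    rw [hκ, mainTerms_eq hX0.ne' PA PB V (S₀ n) (S₁ n), abs_mul, abs_of_nonneg (by positivity)]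
    refine mul_le_mul_of_nonneg_left ?_ (by positivity)
    have hS₀0 : 0 ≤ S₀ n := chainSumA_nonneg X τ n
    have hS₁0 : 0 ≤ S₁ n := chainSumB_nonneg X τ n
    have e7 := h7 z hz7
    have e9 := h9 z hz9
    calc |(6 / Real.pi ^ 2 * PA - σ₀ * V) * S₀ n + σ₀ * (V - gamma₀ * PB) * S₁ n +
            σ₀ * V * (S₀ n - S₁ n)|
        ≤ |(6 / Real.pi ^ 2 * PA - σ₀ * V) * S₀ n| + |σ₀ * (V - gamma₀ * PB) * S₁ n| +
            |σ₀ * V * (S₀ n - S₁ n)| :=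
          (abs_add_le _ _).trans (add_le_add (abs_add_le _ _) le_rfl)
      _ ≤ C₇ * V / Real.log z * S₀ n + σ₀ * (C₉ * V / Real.log z) * S₁ n +
            σ₀ * V * |S₀ n - S₁ n| := by
          refine add_le_add (add_le_add ?_ ?_) (le_of_eq ?_)
          · rw [abs_mul, abs_of_nonneg hS₀0]
            exact mul_le_mul_of_nonneg_right e7 hS₀0
          · rw [abs_mul, abs_mul, abs_of_pos hσ₀, abs_of_nonneg hS₁0, abs_sub_comm]
            exact mul_le_mul_of_nonneg_right (mul_le_mul_of_nonneg_left e9 hσ₀.le) hS₁0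
          · rw [abs_mul, abs_of_nonneg (mul_nonneg hσ₀.le hV0.le)]
  have hpt : ∀ n, |TA n - classKappa σ₀ X η d * TB n| ≤
      (C_A * Sf * Vf * E * S₀ n + remA n) + ω * (κ * (errB C_FL C_W C_B X η τ D * S₁ n)) +
        ω * (η ^ 2 * X ^ 2 * (C₇ * V / Real.log z * S₀ n + σ₀ * (C₉ * V / Real.log z) * S₁ n +
          σ₀ * V * |S₀ n - S₁ n|)) := by
    intro n
    have hMf : Sf * Vf * S₀ n = ω * (sizeA X η * PA * S₀ n) := by
      rw [show Sf * Vf * S₀ n = (Sf * Vf) * S₀ n from rfl, hωeq]; ring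
    have hsplit : TA n - classKappa σ₀ X η d * TB n =
        (TA n - Sf * Vf * S₀ n) - ω * (κ * (TB n - 3 * gamma₀ * η * X ^ 3 * PB * S₁ n)) +
          ω * (sizeA X η * PA * S₀ n - κ * (3 * gamma₀ * η * X ^ 3 * PB * S₁ n)) := by
      rw [hκf, hMf]; ring
    rw [hsplit]
    refine (abs_add_le _ _).trans (add_le_add ((abs_sub _ _).trans (add_le_add (hA n) ?_)) ?_)
    · rw [abs_mul, abs_of_nonneg hω0, abs_mul, abs_of_nonneg hκ0]
      exact mul_le_mul_of_nonneg_left (mul_le_mul_of_nonneg_left (hBn n) hκ0) hω0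
    · rw [abs_mul, abs_of_nonneg hω0]
      exact mul_le_mul_of_nonneg_left (hM n) hω0
  -- sum over `n`
  have hsumS₀ : ∑ n ∈ range N, S₀ n ≤ Real.exp W := sum_chainSumA_le_exp hX τ N
  have hsumS₁ : ∑ n ∈ range N, S₁ n ≤ Real.exp W := sum_chainSumB_le_exp X τ N
  have hsumdiff : ∑ n ∈ range N, |S₀ n - S₁ n| ≤
      Real.exp W * (W * z⁻¹ + 12 / (z / 2) ^ (1 / 3 : ℝ) + 54 / (z / 2)) :=
    sum_abs_chainSumA_sub_chainSumB_le hX (by linarith) (by linarith) N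
  have hsumrem : ∑ n ∈ range N, remA n ≤
      ∑ R ∈ (idealsLE ⌊X ^ (3 / 2 : ℝ)⌋₊).filter (fun R => Squarefree (Ideal.absNorm R)),
        |(classCountA X η d a b R : ℝ) -
          (if Nat.Coprime d (Ideal.absNorm R) then
            classSizeA X η d * rho₂ R / Ideal.absNorm R else 0)| :=
    sum_remaindersClassA_le d a b hX hD N
  have hlogz : 0 < Real.log z := Real.log_pos (by linarith)
  have herrB : 0 ≤ errB C_FL C_W C_B X η τ D := by
    rw [errB]
    have hD0 : 0 < D := by linarith
    have : 0 ≤ Real.log (X ^ τ) := Real.log_nonneg (by linarith)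
    have := (prodB_pos_le (X ^ τ)).1
    have := gamma₀_pos
    positivity
  have hSf0 : 0 ≤ Sf := classSizeA_nonneg X η d
  have hVf0 : 0 ≤ Vf := by
    rw [hVf]
    refine mul_nonneg hPA0.le (prod_nonneg fun p hp => ?_)
    have := (hasSieveDimension_densA.1 p (Nat.prime_of_mem_primeFactors hp)).2
    exact inv_nonneg.mpr (by linarith)
  have hsumB : ∑ n ∈ range N, ω * (κ * (errB C_FL C_W C_B X η τ D * S₁ n)) ≤
      ω * (κ * (errB C_FL C_W C_B X η τ D * Real.exp W)) := by
    rw [← mul_sum, ← mul_sum, ← mul_sum]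
    exact mul_le_mul_of_nonneg_left
      (mul_le_mul_of_nonneg_left (mul_le_mul_of_nonneg_left hsumS₁ herrB) hκ0) hω0
  calc ∑ n ∈ range N, |TA n - classKappa σ₀ X η d * TB n|
      ≤ ∑ n ∈ range N, ((C_A * Sf * Vf * E * S₀ n + remA n) +
          ω * (κ * (errB C_FL C_W C_B X η τ D * S₁ n)) +
          ω * (η ^ 2 * X ^ 2 * (C₇ * V / Real.log z * S₀ n + σ₀ * (C₉ * V / Real.log z) * S₁ n +
            σ₀ * V * |S₀ n - S₁ n|))) :=
        sum_le_sum fun n _ => hpt n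
    _ = C_A * Sf * Vf * E * ∑ n ∈ range N, S₀ n + ∑ n ∈ range N, remA n +
          ∑ n ∈ range N, ω * (κ * (errB C_FL C_W C_B X η τ D * S₁ n)) +
          ω * (η ^ 2 * X ^ 2 * (C₇ * V / Real.log z * ∑ n ∈ range N, S₀ n +
            σ₀ * (C₉ * V / Real.log z) * ∑ n ∈ range N, S₁ n +
              σ₀ * V * ∑ n ∈ range N, |S₀ n - S₁ n|)) := by
        simp only [sum_add_distrib, mul_sum, mul_add]
    _ ≤ C_A * Sf * Vf * E * Real.exp W +
          ∑ R ∈ (idealsLE ⌊X ^ (3 / 2 : ℝ)⌋₊).filter (fun R => Squarefree (Ideal.absNorm R)),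
            |(classCountA X η d a b R : ℝ) -
              (if Nat.Coprime d (Ideal.absNorm R) then
                classSizeA X η d * rho₂ R / Ideal.absNorm R else 0)| +
          ω * (κ * (errB C_FL C_W C_B X η τ D * Real.exp W)) +
          ω * (η ^ 2 * X ^ 2 * (C₇ * V / Real.log z * Real.exp W +
            σ₀ * (C₉ * V / Real.log z) * Real.exp W +
              σ₀ * V * (Real.exp W * (W * z⁻¹ + 12 / (z / 2) ^ (1 / 3 : ℝ) + 54 / (z / 2))))) := by
        have hC7 : 0 ≤ C₇ * V / Real.log z := (abs_nonneg _).trans (h7 z hz7)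
        have hC9 : 0 ≤ σ₀ * (C₉ * V / Real.log z) :=
          mul_nonneg hσ₀.le ((abs_nonneg _).trans (h9 z hz9))
        have hσV : 0 ≤ σ₀ * V := mul_nonneg hσ₀.le hV0.le
        gcongr
    _ = _ := by ring

end Literature.NumberTheory.Sieve.CubicSieve

end
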